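import Literature.NumberTheory.GaloisRepresentations.ProcyclicGenerator
import Literature.NumberTheory.EllipticCurves.ZpExtension
import Mathlib.NumberTheory.Padics.RingHoms
import Mathlib.Topology.MetricSpace.Ultra.TotallySeparated
import HarnessLib

/-!
# `cd_p(ℤ_p) = 1`: the procyclic group `ℤ_p` and the quotient `Γ_K / Gal(K̄/K_∞)` of a
# `ℤ_p`-extension have `p`-cohomological dimension `≤ 1` (Serre, *Cohomologie galoisienne* I §3.4)

Topic `NumberTheory/GaloisRepresentations`; namespace `Literature.NumberTheory.GaloisRepresentations`.
Theorems only (no definition, no named fact; D-0026).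

Serre, *Cohomologie galoisienne* I §3.4: the pro-`p` group `ℤ_p` is free pro-`p` on one generator,
`cd_p(ℤ_p) = 1`; this is the top step `cd_p(Gal(k_∞/k)) = cd_p(ℤ_p) = 1` of II §4.4 Prop. 13
(`cd_p(G_k) ≤ 2` for a number field `k`, along the cyclotomic `ℤ_p`-extension `k_∞/k` of Lemme 1).
In the tree's language (`GroupCdLE`, Mathlib's continuous cohomology of discrete `p`-primary
modules) we prove the upper bound:

* `groupCdLE_one_quotient_ker_of_surjective` — for a compact topological group `G` and a
  continuous SURJECTIVE homomorphism `φ : G →ₜ* ℤ_p` (written multiplicatively), **`cd_p(G / ker φ) ≤ 1`**: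
  every open normal subgroup of `G / ker φ ≅ ℤ_p` contains the image of some `p^n ℤ_p`, so the
  finite quotients are cyclic `p`-groups (generated by the class of `1`, by density of `ℤ` in `ℤ_p`,
  `PadicInt.appr_spec`), of unbounded order (`[ℤ_p : p^n ℤ_p] = p^n`), and
  `groupCdLE_one_of_isCyclic_pGroup` (`ProcyclicGenerator.lean`, Serre I §3.4) applies;
* `groupCdLE_one_quotient_kerSubgroup` — in particular **`cd_p(Γ_K / Gal(K̄/K_∞)) ≤ 1`** for every
  `ℤ_p`-extension `κ : Γ_K ↠ ℤ_p` of a field `K` (`ZpExtension`), e.g. the cyclotomic one.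

(The statement is kept on the quotient `G / ker φ` itself rather than on `ℤ_p`, so that it applies
in the universe of `G`: `GroupCdLE` quantifies over modules in the universe of the group.)

## References

* J.-P. Serre, *Cohomologie galoisienne* / *Galois Cohomology* (1997), I §3.4 (`cd_p(ℤ_p) = 1`),
  II §4.4 Prop. 13 and Lemme 1. [SerreGaloisCohomology1997]
* L. Washington, *Introduction to Cyclotomic Fields* (1997), §13.1 (`ℤ_p`-extensions).
  [Washington1997]
-/

noncomputable section

open Function Topology

universe u

namespace Literature.NumberTheory.GaloisRepresentations

section Padic

variable {p : ℕ} [hp : Fact p.Prime]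

/-- Every neighbourhood of `0` in `ℤ_p` contains an ideal `p^n ℤ_p` (the closed balls
`{‖x‖ ≤ p^{-n}}` form a basis of neighbourhoods of `0`). [folklore] -/
private theorem exists_span_pow_subset_of_mem_nhds {U : Set ℤ_[p]} (hU : U ∈ 𝓝 (0 : ℤ_[p])) :
    ∃ n : ℕ, ((Ideal.span {(p : ℤ_[p]) ^ n} : Ideal ℤ_[p]) : Set ℤ_[p]) ⊆ U := by
  obtain ⟨ε, hε, hball⟩ := Metric.mem_nhds_iff.1 hU
  obtain ⟨n, hn⟩ := PadicInt.exists_pow_neg_lt p hε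
  refine ⟨n, fun x hx => hball ?_⟩
  rw [Metric.mem_ball, dist_zero_right]
  exact lt_of_le_of_lt ((PadicInt.norm_le_pow_iff_mem_span_pow x n).2 hx) hn

end Padic

section Quotient

variable {G : Type u} [Group G] [TopologicalSpace G] {p : ℕ} [hp : Fact p.Prime]
  (φ : G →ₜ* Multiplicative ℤ_[p])

/-- The subgroup `φ⁻¹(p^n ℤ_p) ≤ G` cutting out the `n`-th layer of the `ℤ_p`-tower of `φ`
(Washington §13.1: `K_n` is the fixed field of `κ⁻¹(p^n ℤ_p)`): membership is `p^n ∣ φ σ`.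
[cite: Washington1997, §13.1] -/
theorem mem_comap_span_pow_iff (n : ℕ) (σ : G) :
    σ ∈ (AddSubgroup.toSubgroup (Ideal.span {(p : ℤ_[p]) ^ n}).toAddSubgroup).comap φ.toMonoidHom ↔
      (p : ℤ_[p]) ^ n ∣ (φ σ).toAdd := by
  rw [Subgroup.mem_comap, Multiplicative.mem_toSubgroup, Submodule.mem_toAddSubgroup,
    Ideal.mem_span_singleton]
  rfl

/-- The layer subgroup `φ⁻¹(p^n ℤ_p)` is open in `G` (`p^n ℤ_p` is an open ball of `ℤ_p`;
Washington §13.1: the layers `K_n/K` of a `ℤ_p`-extension are finite). [cite: Washington1997, §13.1] -/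
theorem isOpen_comap_span_pow (n : ℕ) :
    IsOpen (((AddSubgroup.toSubgroup (Ideal.span {(p : ℤ_[p]) ^ n}).toAddSubgroup).comap φ.toMonoidHom :
      Subgroup G) : Set G) := by
  have hball : ((Ideal.span {(p : ℤ_[p]) ^ n} : Ideal ℤ_[p]) : Set ℤ_[p]) =
      Metric.closedBall (0 : ℤ_[p]) ((p : ℝ) ^ (-n : ℤ)) := by
    ext x
    rw [SetLike.mem_coe, Metric.mem_closedBall, dist_zero_right, PadicInt.norm_le_pow_iff_mem_span_pow]
  have hopen : IsOpen ((Ideal.span {(p : ℤ_[p]) ^ n} : Ideal ℤ_[p]) : Set ℤ_[p]) := by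
    rw [hball]
    refine IsUltrametricDist.isOpen_closedBall _ (zpow_ne_zero _ ?_)
    exact_mod_cast hp.out.ne_zero
  exact hopen.preimage (map_continuous φ)

/-- `ker φ ≤ φ⁻¹(p^n ℤ_p)`. [folklore] -/
private theorem ker_le_comap_span_pow (n : ℕ) :
    φ.toMonoidHom.ker ≤
      (AddSubgroup.toSubgroup (Ideal.span {(p : ℤ_[p]) ^ n}).toAddSubgroup).comap φ.toMonoidHom := by
  intro σ hσ
  rw [mem_comap_span_pow_iff]
  have h1 : φ σ = 1 := hσ
  rw [h1, toAdd_one]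
  exact dvd_zero _

/-- For `φ` surjective, `[G : φ⁻¹(p^n ℤ_p)] = p^n`. [folklore] -/
private theorem index_comap_span_pow_of_surjective (hφ : Surjective φ) (n : ℕ) :
    ((AddSubgroup.toSubgroup (Ideal.span {(p : ℤ_[p]) ^ n}).toAddSubgroup).comap φ.toMonoidHom).index =
      p ^ n := by
  rw [Subgroup.index_comap_of_surjective _ hφ]
  exact Literature.NumberTheory.EllipticCurves.ZpExtension.index_toSubgroup_span_pow n

variable [CompactSpace G]

/-- **Every open normal subgroup of `G / ker φ` pulls back to an open subgroup of `G` containing some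
`φ⁻¹(p^n ℤ_p)`** (`φ` surjective): its preimage in `G` is open and contains `ker φ`, so its image
`φ(·)` is a neighbourhood of `0` in `ℤ_p` — by the open mapping property of the quotient map
`G → ℤ_p`, here obtained from compactness: `φ` is a closed continuous surjection, hence a quotient
map. [folklore] -/
private theorem exists_comap_span_pow_le_comap (hφ : Surjective φ) (H : Subgroup (G ⧸ φ.toMonoidHom.ker))
    (hH : IsOpen (H : Set (G ⧸ φ.toMonoidHom.ker))) :
    ∃ n : ℕ, (AddSubgroup.toSubgroup (Ideal.span {(p : ℤ_[p]) ^ n}).toAddSubgroup).comap φ.toMonoidHom ≤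
      H.comap (QuotientGroup.mk' φ.toMonoidHom.ker) := by
  classical
  -- the preimage `H₁ ≤ G` of `H`
  set H₁ : Subgroup G := H.comap (QuotientGroup.mk' φ.toMonoidHom.ker) with hH₁
  have hH₁open : IsOpen (H₁ : Set G) := hH.preimage (QuotientGroup.continuous_mk)
  have hkerH₁ : φ.toMonoidHom.ker ≤ H₁ := by
    intro σ hσ
    rw [hH₁, Subgroup.mem_comap, QuotientGroup.mk'_apply, (QuotientGroup.eq_one_iff σ).2 hσ]
    exact one_mem _
  -- `φ(H₁)` is a neighbourhood of `0`: `φ` is a quotient map (closed continuous surjection)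
  have hquot : IsQuotientMap (φ : G → Multiplicative ℤ_[p]) :=
    (map_continuous φ).isClosedMap.isQuotientMap (map_continuous φ) hφ
  have himg_open : IsOpen ((φ : G → Multiplicative ℤ_[p]) '' (H₁ : Set G)) := by
    rw [← hquot.isOpen_preimage]
    have hsat : (φ : G → Multiplicative ℤ_[p]) ⁻¹' ((φ : G → Multiplicative ℤ_[p]) '' (H₁ : Set G)) =
        (H₁ : Set G) := by
      ext σ
      constructor
      · rintro ⟨τ, hτ, hτσ⟩
        have hmem : τ⁻¹ * σ ∈ φ.toMonoidHom.ker := by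
          rw [MonoidHom.mem_ker, map_mul, map_inv]
          change (φ τ)⁻¹ * φ σ = 1
          rw [hτσ, inv_mul_cancel]
        have h2 := H₁.mul_mem hτ (hkerH₁ hmem)
        rwa [mul_inv_cancel_left] at h2
      · intro hσ
        exact ⟨σ, hσ, rfl⟩
    rw [hsat]
    exact hH₁open
  have hmem0 : (0 : ℤ_[p]) ∈ Multiplicative.toAdd '' ((φ : G → Multiplicative ℤ_[p]) '' (H₁ : Set G)) :=
    ⟨1, ⟨1, H₁.one_mem, map_one φ⟩, rfl⟩
  have himg_open' : IsOpen (Multiplicative.toAdd '' ((φ : G → Multiplicative ℤ_[p]) '' (H₁ : Set G))) := by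
    rw [Set.image_eq_preimage_of_inverse (f := (Multiplicative.toAdd : Multiplicative ℤ_[p] → ℤ_[p]))
      (g := Multiplicative.ofAdd) (fun _ => rfl) (fun _ => rfl)]
    exact himg_open.preimage continuous_ofAdd
  obtain ⟨n, hn⟩ := exists_span_pow_subset_of_mem_nhds (himg_open'.mem_nhds hmem0)
  refine ⟨n, fun σ hσ => ?_⟩
  rw [mem_comap_span_pow_iff, ← Ideal.mem_span_singleton] at hσ
  obtain ⟨y, ⟨τ, hτ, hτy⟩, hy⟩ := hn hσ
  -- `φ τ = φ σ` with `τ ∈ H₁`, so `σ ∈ H₁`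
  have hφeq : φ τ = φ σ := by
    rw [← ofAdd_toAdd (φ τ), ← ofAdd_toAdd (φ σ)]
    exact congrArg Multiplicative.ofAdd (by rw [← hy, hτy])
  have hmem : τ⁻¹ * σ ∈ φ.toMonoidHom.ker := by
    rw [MonoidHom.mem_ker, map_mul, map_inv]
    change (φ τ)⁻¹ * φ σ = 1
    rw [hφeq, inv_mul_cancel]
  have h2 := H₁.mul_mem hτ (hkerH₁ hmem)
  rwa [mul_inv_cancel_left] at h2

/-- **The finite quotients of `G / ker φ` are `p`-groups** (`φ` surjective): an open normal
`H ≤ G / ker φ` contains the image of `φ⁻¹(p^n ℤ_p)`, and `σ^{p^n} ∈ φ⁻¹(p^n ℤ_p)` for every `σ`.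
[cite: SerreGaloisCohomology1997, I §3.4] -/
theorem isPGroup_quotient_of_isOpen (hφ : Surjective φ) (H : Subgroup (G ⧸ φ.toMonoidHom.ker)) [H.Normal]
    (hH : IsOpen (H : Set (G ⧸ φ.toMonoidHom.ker))) : IsPGroup p ((G ⧸ φ.toMonoidHom.ker) ⧸ H) := by
  obtain ⟨n, hn⟩ := exists_comap_span_pow_le_comap φ hφ H hH
  intro x
  obtain ⟨q, rfl⟩ := QuotientGroup.mk_surjective x
  obtain ⟨σ, rfl⟩ := QuotientGroup.mk_surjective q
  refine ⟨n, ?_⟩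
  rw [← QuotientGroup.mk_pow, QuotientGroup.eq_one_iff, ← QuotientGroup.mk_pow]
  have hmem : σ ^ p ^ n ∈ (AddSubgroup.toSubgroup (Ideal.span {(p : ℤ_[p]) ^ n}).toAddSubgroup).comap
      φ.toMonoidHom := by
    rw [mem_comap_span_pow_iff, map_pow, toAdd_pow, nsmul_eq_mul, Nat.cast_pow]
    exact dvd_mul_right _ _
  exact hn hmem

/-- **The finite quotients of `G / ker φ` are cyclic** (`φ` surjective), generated by the class of
any `γ` with `φ γ = 1 ∈ ℤ_p`: for `σ ∈ G` and `H ⊇ (image of) φ⁻¹(p^n ℤ_p)`, the `p`-adic integer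
`φ σ` is congruent to an ordinary integer `a` modulo `p^n` (`PadicInt.appr_spec`), so
`σ ≡ γ^a`. [cite: SerreGaloisCohomology1997, I §3.4] [cite: Washington1997, §13.1] -/
theorem isCyclic_quotient_of_isOpen (hφ : Surjective φ) (H : Subgroup (G ⧸ φ.toMonoidHom.ker)) [H.Normal]
    (hH : IsOpen (H : Set (G ⧸ φ.toMonoidHom.ker))) : IsCyclic ((G ⧸ φ.toMonoidHom.ker) ⧸ H) := by
  obtain ⟨n, hn⟩ := exists_comap_span_pow_le_comap φ hφ H hH
  obtain ⟨γ, hγ⟩ := hφ (Multiplicative.ofAdd 1)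
  refine ⟨⟨QuotientGroup.mk (QuotientGroup.mk γ), fun x => ?_⟩⟩
  obtain ⟨q, rfl⟩ := QuotientGroup.mk_surjective x
  obtain ⟨σ, rfl⟩ := QuotientGroup.mk_surjective q
  refine ⟨((PadicInt.appr (φ σ).toAdd n : ℕ) : ℤ), ?_⟩
  beta_reduce
  rw [zpow_natCast, ← QuotientGroup.mk_pow, ← QuotientGroup.mk_pow, QuotientGroup.eq,
    ← QuotientGroup.mk_inv, ← QuotientGroup.mk_mul]
  have hmem : (γ ^ PadicInt.appr (φ σ).toAdd n)⁻¹ * σ ∈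
      (AddSubgroup.toSubgroup (Ideal.span {(p : ℤ_[p]) ^ n}).toAddSubgroup).comap φ.toMonoidHom := by
    rw [mem_comap_span_pow_iff, map_mul, map_inv, map_pow, hγ, toAdd_mul, toAdd_inv, toAdd_pow,
      toAdd_ofAdd, nsmul_eq_mul, mul_one, ← Ideal.mem_span_singleton]
    have h := PadicInt.appr_spec n (φ σ).toAdd
    have heq : -((PadicInt.appr (φ σ).toAdd n : ℕ) : ℤ_[p]) + (φ σ).toAdd =
        (φ σ).toAdd - (PadicInt.appr (φ σ).toAdd n : ℕ) := by ring
    rw [heq]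
    exact h
  exact hn hmem

variable [IsTopologicalGroup G]

omit [CompactSpace G] in
/-- **`G / ker φ` has open normal subgroups of unbounded index** (`φ` surjective): the image of
`φ⁻¹(p^n ℤ_p)` has index `p^n ≥ n`. [cite: SerreGaloisCohomology1997, I §3.4] -/
theorem exists_isOpen_normal_le_index (hφ : Surjective φ) (n : ℕ) :
    ∃ H : Subgroup (G ⧸ φ.toMonoidHom.ker), H.Normal ∧ IsOpen (H : Set (G ⧸ φ.toMonoidHom.ker)) ∧
      n ≤ H.index := by
  classical
  set S : Subgroup G := (AddSubgroup.toSubgroup (Ideal.span {(p : ℤ_[p]) ^ n}).toAddSubgroup).comap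
    φ.toMonoidHom with hS
  haveI hSn : S.Normal := by rw [hS]; exact Subgroup.Normal.comap inferInstance _
  refine ⟨S.map (QuotientGroup.mk' φ.toMonoidHom.ker), ?_, ?_, ?_⟩
  · exact Subgroup.Normal.map hSn _ (QuotientGroup.mk'_surjective _)
  · -- the image of an open subgroup under the open map `G → G / ker φ`
    exact QuotientGroup.isOpenMap_coe _ (isOpen_comap_span_pow φ n)
  · have hidx : (S.map (QuotientGroup.mk' φ.toMonoidHom.ker)).index = S.index := by
      refine Subgroup.index_map_eq _ (QuotientGroup.mk'_surjective _) ?_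
      rw [QuotientGroup.ker_mk']
      exact ker_le_comap_span_pow φ n
    rw [hidx, hS, index_comap_span_pow_of_surjective φ hφ n]
    exact (Nat.lt_pow_self hp.out.one_lt).le

/-- **`cd_p(G / ker φ) ≤ 1` for a continuous surjection `φ : G ↠ ℤ_p` from a compact group**
(`G / ker φ ≅ ℤ_p`; Serre I §3.4: `cd_p(ℤ_p) = 1`): the finite quotients of `G / ker φ` are cyclic
`p`-groups of unbounded order, and `groupCdLE_one_of_isCyclic_pGroup` (`ProcyclicGenerator.lean`)
applies. [cite: SerreGaloisCohomology1997, I §3.4] -/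
theorem groupCdLE_one_quotient_ker_of_surjective (hφ : Surjective φ) :
    GroupCdLE (G ⧸ φ.toMonoidHom.ker) p 1 := by
  -- `G / ker φ ≅ ℤ_p` is totally disconnected
  let e₀ : G ⧸ φ.toMonoidHom.ker ≃* Multiplicative ℤ_[p] :=
    QuotientGroup.quotientKerEquivOfSurjective φ.toMonoidHom hφ
  have he₀mk : ∀ g : G, e₀ (QuotientGroup.mk g) = φ g := fun g => rfl
  have he₀ : Continuous e₀ := by
    rw [(QuotientGroup.isQuotientMap_mk φ.toMonoidHom.ker).continuous_iff]
    have h : (e₀ : G ⧸ φ.toMonoidHom.ker → Multiplicative ℤ_[p]) ∘ QuotientGroup.mk = φ :=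
      funext he₀mk
    rw [h]
    exact map_continuous φ
  let e₁ : G ⧸ φ.toMonoidHom.ker ≃ₜ Multiplicative ℤ_[p] :=
    Continuous.homeoOfEquivCompactToT2 (f := e₀.toEquiv) he₀
  haveI : TotallyDisconnectedSpace (G ⧸ φ.toMonoidHom.ker) := Homeomorph.totallyDisconnectedSpace e₁.symm
  exact groupCdLE_one_of_isCyclic_pGroup (Q := G ⧸ φ.toMonoidHom.ker) p
    (fun H _ hH => isCyclic_quotient_of_isOpen φ hφ H hH)
    (fun H _ hH => isPGroup_quotient_of_isOpen φ hφ H hH)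
    (fun n => exists_isOpen_normal_le_index φ hφ n)

end Quotient

section ZpExtension

open Field Literature.NumberTheory.EllipticCurves

variable {K : Type u} [Field K] {p : ℕ} [Fact p.Prime] (κ : ZpExtension K p)

/-- **`cd_p(Γ_K / Gal(K̄/K_∞)) ≤ 1` for a `ℤ_p`-extension `K_∞/K`** (`Gal(K_∞/K) ≅ ℤ_p` and
`cd_p(ℤ_p) = 1`, Serre I §3.4; the top step of II §4.4 Prop. 13 along the cyclotomic
`ℤ_p`-extension of Lemme 1): `κ : Γ_K ↠ ℤ_p` is a continuous surjection from the compact group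
`Γ_K`, with kernel `ker κ = κ.kerSubgroup = Gal(K̄/K_∞)` (definitionally; the statement uses the
`MonoidHom.ker` spelling, which carries the `Normal` instance). [cite: SerreGaloisCohomology1997, I §3.4 and II §4.4 Prop. 13 (Lemme 1)]
[cite: Washington1997, §13.1] -/
theorem groupCdLE_one_quotient_kerSubgroup :
    GroupCdLE (absoluteGaloisGroup K ⧸ κ.toContinuousMonoidHom.toMonoidHom.ker) p 1 := by
  haveI := absoluteGaloisGroup_compactSpace K
  exact groupCdLE_one_quotient_ker_of_surjective κ.toContinuousMonoidHom κ.surjective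

end ZpExtension

end Literature.NumberTheory.GaloisRepresentations

end
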